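import Summits.BirchSwinnertonDyer.BirchSwinnertonDyer.Theorems.EisensteinPrimesUnrSelmerNaturalLocalization
import Literature.NumberTheory.EllipticCurves.IwasawaSelmerProofs
import HarnessLib

/-!
# Adapter: the `∃`-form `K_∞`-side global-to-local surjectivity with ARBITRARY representatives
# `σrep w i` (`κ(σrep w i) = i`) and exponents `a_w` (`κ(D_w) = p^{a_w} ℤ_p`) ⇒ the conclusion of
# `prop125_residualPair_unrSelmer_corank_ge` for `(F/𝒪)(θ)`

Cell `bsd-eis` (home `run/shared/lean/pub/bsd-eis/`), seat `bsd-line-x1-p1-w2` (gen 1; D-0154 width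
seat on crux 2 `GoodLatticeBDPValue` = stmt-BirchSwinnertonDyer-19032, line `halves` v16, stub
`stub_imprimCorank` = `KellerYin2024.prop125_residualPair_unrSelmer_corank_ge`). Sequel of
`EisensteinPrimesUnrSelmerNaturalLocalization` (surjectivity of the CANONICAL localisation
`c ↦ (res_{ker κ ⊓ D_w} conj_{γ^i} c)` ⇒ `Σ charLocalLambda ≤ zpCorank(Sel^{Sf}/Sel^∅)`). The cell's
`K_∞`-side surjectivity (LEAD g2, road (A), `AcTwistDeformationLocSurj.exists_mem_unrSelmer_forall_resOfLe_conjH1_eq`,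
from Greenberg 2016 Prop. 2.6.3 + Greenberg 2006 + [RH] by name) is stated with ARBITRARY
representatives `σrep w i ∈ Γ_K`, `κ(σrep w i) = i` for `i < p^{a_w}`, and the exponent currency
`(a, hdiv, hd₀)` for `[Γ:Γ_w] = p^{a_w}`. This file removes the last syntactic gap:

* §1 `conjH1_eq_of_apply_eq` — GENERIC: `κ σ = κ τ ⇒ conj_σ = conj_τ` on `H¹(ker κ, M)` (`σ τ⁻¹ ∈ ker κ`
  acts trivially: `conjH1_of_mem_holds`); `surjective_pi_resOfLe_conjH1_pow_of_forall_exists` — the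
  `∃`-form with any `σrep`, `κ(σrep w i) = i` (`i < N w`), implies the surjectivity of the canonical
  bundled map with `γ^i` (`κ(γ^i) = i`, `toAdd_apply_pow_of_isTopGenerator`).
* §2 **`sum_charLocalLambda_le_zpCorank_unrSelmer_quotient_at_residualPair_of_forall_exists`** —
  under the binders of `prop125_residualPair_unrSelmer_corank_ge` (`K` imaginary quadratic, `2 < p`,
  (Heeg) for `N`, `κ` anticyclotomic with topological generator `γ`, `θ ∈ {θsub, θquot}` of a residual
  pair, `Sf` = primes over `N` off `p`): from `(a, hdiv, hd₀)`, `(σrep, hσrep)` and the `∃`-form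
  surjectivity IN EXACTLY THE SHAPE OF THE CELL'S LocSurj CONCLUSION, the stub's conclusion
  **`Σ_{w∈Sf} charLocalLambda ∅ κ θ w ≤ zpCorank (Sel^{Sf}/Sel^∅) p`**. With LocSurj this is the
  `≥` half for each residual character; nothing else of road (A)'s `K_∞` side remains.

HONEST FRAMING: tool theorems only (no definition, no named fact, no `sorry`); the `∃`-form
surjectivity is a HYPOTHESIS (discharged by the LocSurj file from PUB facts by name + [RH]); closes
nothing by itself (`--supports stmt-BirchSwinnertonDyer-19032`); BSD / Mazur's MC / IMC is proved for
no curve here.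

References: Keller–Yin arXiv:2402.12781v2 Prop. 1.2.5 (TeX L780–800), Lemma 1.1.1 (L455–462);
Greenberg–Vatsal, Invent. Math. 142 (2000) §2 Cor. (2.3), Prop. (2.4); Serre, *Local Fields* VII §5
Prop. 3 (inner automorphisms act trivially on cohomology); Pollack–Weston 2011 App. A Prop. A.2.
-/

-- `Summit.BirchSwinnertonDyer.BirchSwinnertonDyer.…`: summit and sub-problem share a name (D-0017 layout).
set_option linter.dupNamespace false
set_option autoImplicit false

noncomputable section

open scoped Classical AddSubgroup Pointwise

open CategoryTheory Function Filter Polynomial NumberField IsDedekindDomain Field ValuativeRel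
open Literature.NumberTheory.EllipticCurves Literature.NumberTheory.EllipticCurves.GreenbergSelmer
  Literature.NumberTheory.EllipticCurves.GreenbergVatsal2000
  Literature.NumberTheory.GaloisRepresentations
  Literature.NumberTheory.EllipticCurves.KellerYin2024 Literature.NumberTheory.IwasawaTheory
  IsDedekindDomain.HeightOneSpectrum
  Summit.BirchSwinnertonDyer.Rank1Residual
  Summit.BirchSwinnertonDyer.BirchSwinnertonDyer.Theorems.UnrSelmerNaturalLocalization

namespace Summit.BirchSwinnertonDyer.BirchSwinnertonDyer.Theorems.UnrSelmerLocSurjAdapter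

variable {K : Type} [Field K] [NumberField K] {p : ℕ} [hp : Fact p.Prime] (κ : ZpExtension K p)

/-! ## §1 `κ σ = κ τ ⇒ conj_σ = conj_τ`; arbitrary representatives ⇒ the canonical map -/

section Generic

variable {M : Type} [AddCommGroup M] [DistribMulAction (absoluteGaloisGroup K) M] [TopologicalSpace M]
  [DiscreteTopology M]

omit [NumberField K] in
/-- **`κ σ = κ τ ⇒ conj_σ = conj_τ` on `H¹(Gal(K̄/K_∞), M)`**: `σ = (σ τ⁻¹) τ` with `σ τ⁻¹ ∈ ker κ`,
and elements of `ker κ` act trivially on `H¹(ker κ, M)` (`conjH1_of_mem_holds`: inner automorphisms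
act trivially on cohomology). So the conjugation action on `H¹(K_∞, M)` factors through
`Γ = Gal(K_∞/K)`. [cite: SerreLocalFields1979, VII.§5 Prop. 3] [cite: NeukirchSchmidtWingberg2008, (1.6.3)] -/
theorem conjH1_eq_of_apply_eq {σ τ : absoluteGaloisGroup K} (h : κ σ = κ τ) :
    conjH1 κ.kerSubgroup M σ = conjH1 κ.kerSubgroup M τ := by
  haveI : κ.kerSubgroup.Normal := by rw [ZpExtension.kerSubgroup]; infer_instance
  have hmem : σ * τ⁻¹ ∈ κ.kerSubgroup := by
    rw [ZpExtension.mem_kerSubgroup, map_mul, map_inv, h, mul_inv_cancel]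
  have hστ : σ = σ * τ⁻¹ * τ := by rw [inv_mul_cancel_right]
  rw [hστ, Literature.NumberTheory.EllipticCurves.conjH1_mul_holds κ.kerSubgroup M (σ * τ⁻¹) τ,
    Literature.NumberTheory.EllipticCurves.conjH1_of_mem_holds κ.kerSubgroup M hmem,
    AddMonoidHom.id_comp]

/-- **Arbitrary representatives ⇒ the canonical map is onto.** If, for every family of local
targets `y w i`, some `u ∈ H¹_{𝓕_nr^{Sf}}(K_∞, M)` has `res_{ker κ ⊓ D_w}(conj_{σrep w i} u) = y w i`
for all `w ∈ Sf`, `i < N w` — the `∃`-form of the cell's `K_∞`-side global-to-local surjectivity,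
with representatives `σrep w i` subject only to `κ(σrep w i) = i` — then the bundled canonical map
`u ↦ (res_{ker κ ⊓ D_w} conj_{γ^i} u)_{w∈Sf, i<N w}` (`γ` a topological generator, `κ(γ^i) = i`) is
SURJECTIVE (`conjH1_eq_of_apply_eq`, `surjective_pi_of_forall_exists`).
[cite: GreenbergVatsal2000, §2 pp. 20–21] [cite: KellerYin2024, Prop. 1.2.5 (eq:Gr to imp) (arXiv:2402.12781v2 TeX L789–800)] -/
theorem surjective_pi_resOfLe_conjH1_pow_of_forall_exists {γ : absoluteGaloisGroup K}
    (hγ : κ.IsTopGenerator γ) (vbar : HeightOneSpectrum (𝓞 K)) (Sf : Finset (HeightOneSpectrum (𝓞 K)))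
    (N : HeightOneSpectrum (𝓞 K) → ℕ) (σrep : HeightOneSpectrum (𝓞 K) → ℕ → absoluteGaloisGroup K)
    (hσrep : ∀ w ∈ Sf, ∀ i : ℕ, i < N w → (κ (σrep w i)).toAdd = (i : ℤ_[p]))
    (hsurj : ∀ y : (w : HeightOneSpectrum (𝓞 K)) → ℕ →
        Literature.NumberTheory.EllipticCurves.subgroupH1 (κ.kerSubgroup ⊓ decomp (K := K) w) M,
      ∃ u ∈ unrSelmer κ M vbar (↑Sf : Set (HeightOneSpectrum (𝓞 K))),
        ∀ w ∈ Sf, ∀ i : ℕ, i < N w →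
          resOfLe M (inf_le_left : κ.kerSubgroup ⊓ decomp (K := K) w ≤ κ.kerSubgroup)
            (conjH1 κ.kerSubgroup M (σrep w i) u) = y w i) :
    Surjective ((AddMonoidHom.pi fun w : ↥Sf ↦
        AddMonoidHom.pi fun i : Fin (N (w : HeightOneSpectrum (𝓞 K))) ↦
          (resOfLe M (inf_le_left :
              κ.kerSubgroup ⊓ decomp (K := K) (w : HeightOneSpectrum (𝓞 K)) ≤ κ.kerSubgroup)).comp
            (conjH1 κ.kerSubgroup M (γ ^ (i : ℕ)))).comp
        (unrSelmer κ M vbar (↑Sf : Set (HeightOneSpectrum (𝓞 K)))).subtype) := by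
  refine surjective_pi_of_forall_exists (unrSelmer κ M vbar (↑Sf : Set (HeightOneSpectrum (𝓞 K))))
    Sf N (fun w i ↦ (resOfLe M (inf_le_left :
      κ.kerSubgroup ⊓ decomp (K := K) w ≤ κ.kerSubgroup)).comp (conjH1 κ.kerSubgroup M (γ ^ i)))
    fun y ↦ ?_
  obtain ⟨u, hu, h⟩ := hsurj y
  refine ⟨u, hu, fun w hw i hi ↦ ?_⟩
  have hκ : κ (γ ^ i) = κ (σrep w i) :=
    Multiplicative.toAdd.injective (by rw [toAdd_apply_pow_of_isTopGenerator κ hγ i, hσrep w hw i hi])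
  rw [AddMonoidHom.comp_apply, conjH1_eq_of_apply_eq κ hκ]
  exact h w hw i hi

end Generic

/-! ## §2 The stub's conclusion at a residual character from the `∃`-form surjectivity -/

section Character

variable (θ : FramedGaloisRep K (padicCoeffIntegers (∅ : Set (PadicAlgCl p))) 1)
  (vbar : HeightOneSpectrum (𝓞 K)) (Sf : Finset (HeightOneSpectrum (𝓞 K)))

/-- **`Σ_{w∈Sf} charLocalLambda ∅ κ θ w ≤ zpCorank (H¹_{𝓕_nr^{Sf}}/H¹_{𝓕_nr}) p` for `(F/𝒪)(θ)`,
`θ^{p−1} = 1`, from the `∃`-form surjectivity with arbitrary representatives** (`κ` any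
`ℤ_p`-extension with topological generator `γ`; `Sf` finite, `w ∤ p`, finitely decomposed; exponent
currency `(a, hdiv, hd₀)`: `p^{a_w} ∣ κ δ` on `D_w`, attained; `σrep w i` with `κ(σrep w i) = i`).
[cite: KellerYin2024, Prop. 1.2.5, Lemma 1.1.1 (arXiv:2402.12781v2 TeX L780–800, L455–462)]
[cite: CastellaGrossiLeeSkinner2022, Prop. 1.2.5 (eq:sur1)–(eq:sur2)] [cite: GreenbergVatsal2000, §2 Cor. (2.3), Prop. (2.4)] -/
theorem sum_charLocalLambda_le_zpCorank_unrSelmer_quotient_of_forall_exists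
    (hθ : ∀ σ : absoluteGaloisGroup K, θ σ ^ (p - 1) = 1) {γ : absoluteGaloisGroup K}
    (hγ : κ.IsTopGenerator γ) (hSfp : ∀ w ∈ Sf, ((p : ℕ) : 𝓞 K) ∉ w.asIdeal)
    (hSfdec : ∀ w ∈ Sf, ∃ δ ∈ decomp (K := K) w, κ δ ≠ 1)
    (a : HeightOneSpectrum (𝓞 K) → ℕ)
    (hdiv : ∀ w ∈ Sf, ∀ δ ∈ decomp (K := K) w, (p : ℤ_[p]) ^ a w ∣ (κ δ).toAdd)
    (hd₀ : ∀ w ∈ Sf, ∃ δ ∈ decomp (K := K) w, (κ δ).toAdd = (p : ℤ_[p]) ^ a w)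
    (σrep : HeightOneSpectrum (𝓞 K) → ℕ → absoluteGaloisGroup K)
    (hσrep : ∀ w ∈ Sf, ∀ i : ℕ, i < p ^ a w → (κ (σrep w i)).toAdd = (i : ℤ_[p]))
    (hsurj : ∀ y : (w : HeightOneSpectrum (𝓞 K)) → ℕ →
        Literature.NumberTheory.EllipticCurves.subgroupH1 (κ.kerSubgroup ⊓ decomp (K := K) w)
          (charModule (∅ : Set (PadicAlgCl p)) θ),
      ∃ u ∈ unrSelmer κ (charModule (∅ : Set (PadicAlgCl p)) θ) vbar (↑Sf : Set (HeightOneSpectrum (𝓞 K))),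
        ∀ w ∈ Sf, ∀ i : ℕ, i < p ^ a w →
          resOfLe (charModule (∅ : Set (PadicAlgCl p)) θ)
              (inf_le_left : κ.kerSubgroup ⊓ decomp (K := K) w ≤ κ.kerSubgroup)
            (conjH1 κ.kerSubgroup (charModule (∅ : Set (PadicAlgCl p)) θ) (σrep w i) u) = y w i) :
    ∑ w ∈ Sf, charLocalLambda (∅ : Set (PadicAlgCl p)) κ θ w ≤
      zpCorank (↥(unrSelmer κ (charModule (∅ : Set (PadicAlgCl p)) θ) vbar
          (↑Sf : Set (HeightOneSpectrum (𝓞 K)))) ⧸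
        (unrSelmer κ (charModule (∅ : Set (PadicAlgCl p)) θ) vbar
          (∅ : Set (HeightOneSpectrum (𝓞 K)))).addSubgroupOf
            (unrSelmer κ (charModule (∅ : Set (PadicAlgCl p)) θ) vbar
              (↑Sf : Set (HeightOneSpectrum (𝓞 K))))) p := by
  have hN : ∀ w ∈ Sf, p ^ a w = numPlacesAbove κ w := fun w hw ↦
    (numPlacesAbove_eq_pow_of_forall_dvd κ w (hdiv w hw) (hd₀ w hw)).symm
  exact sum_charLocalLambda_le_zpCorank_unrSelmer_quotient_of_pi_surjective κ θ vbar Sf hθ hγ hSfp hSfdec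
    (fun w ↦ p ^ a w) hN
    (surjective_pi_resOfLe_conjH1_pow_of_forall_exists κ hγ vbar Sf (fun w ↦ p ^ a w) σrep hσrep hsurj)

/-- **The conclusion of `KellerYin2024.prop125_residualPair_unrSelmer_corank_ge` for `θ ∈ {θsub, θquot}`
from the `∃`-form `K_∞`-side global-to-local surjectivity in EXACTLY the shape the cell's LocSurj
file concludes** (arbitrary `σrep` with `κ(σrep w i) = i`, exponent currency `(a, hdiv, hd₀)`),
under the stub's binders: `K` imaginary quadratic, `2 < p`, (Heeg) for `N`, `κ` anticyclotomic with
topological generator `γ`, `IsResidualPairOver WK p θsub θquot`, `Sf` = primes over `N` off `p`.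
So the `≥` half for each residual character = [LocSurj from SUR(𝐃₁(θ), 𝓛_v) = Greenberg 2016 Prop.
2.6.3 + Greenberg 2006 facts + [RH], BY NAME] ∘ this theorem.
[cite: KellerYin2024, Prop. 1.2.5, Lemma 1.1.1, §1.4 (arXiv:2402.12781v2 TeX L780–800, L455–462, L1066–1081)]
[cite: CastellaGrossiLeeSkinner2022, Prop. 1.2.5] [cite: Brink2007, Thm. 2] [cite: PollackWeston2011, App. A Prop. A.2] -/
theorem sum_charLocalLambda_le_zpCorank_unrSelmer_quotient_at_residualPair_of_forall_exists
    (hK : IsImaginaryQuadratic K) (hp2 : 2 < p) {N : ℕ} (hH : SatisfiesHeegnerHypothesis N K)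
    {WK : WeierstrassCurve K} (hκ : κ.IsAnticyclotomic) {γ : absoluteGaloisGroup K}
    (hγ : κ.IsTopGenerator γ)
    (θsub θquot : FramedGaloisRep K (padicCoeffIntegers (∅ : Set (PadicAlgCl p))) 1)
    (hpair : IsResidualPairOver WK p θsub θquot)
    (hSf : ∀ w : HeightOneSpectrum (𝓞 K), w ∈ Sf ↔ ((N : ℤ) : 𝓞 K) ∈ w.asIdeal)
    (hSp : ∀ w ∈ Sf, ((p : ℕ) : 𝓞 K) ∉ w.asIdeal) (hθ : θ = θsub ∨ θ = θquot)
    (a : HeightOneSpectrum (𝓞 K) → ℕ)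
    (hdiv : ∀ w ∈ Sf, ∀ δ ∈ decomp (K := K) w, (p : ℤ_[p]) ^ a w ∣ (κ δ).toAdd)
    (hd₀ : ∀ w ∈ Sf, ∃ δ ∈ decomp (K := K) w, (κ δ).toAdd = (p : ℤ_[p]) ^ a w)
    (σrep : HeightOneSpectrum (𝓞 K) → ℕ → absoluteGaloisGroup K)
    (hσrep : ∀ w ∈ Sf, ∀ i : ℕ, i < p ^ a w → (κ (σrep w i)).toAdd = (i : ℤ_[p]))
    (hsurj : ∀ y : (w : HeightOneSpectrum (𝓞 K)) → ℕ →
        Literature.NumberTheory.EllipticCurves.subgroupH1 (κ.kerSubgroup ⊓ decomp (K := K) w)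
          (charModule (∅ : Set (PadicAlgCl p)) θ),
      ∃ u ∈ unrSelmer κ (charModule (∅ : Set (PadicAlgCl p)) θ) vbar (↑Sf : Set (HeightOneSpectrum (𝓞 K))),
        ∀ w ∈ Sf, ∀ i : ℕ, i < p ^ a w →
          resOfLe (charModule (∅ : Set (PadicAlgCl p)) θ)
              (inf_le_left : κ.kerSubgroup ⊓ decomp (K := K) w ≤ κ.kerSubgroup)
            (conjH1 κ.kerSubgroup (charModule (∅ : Set (PadicAlgCl p)) θ) (σrep w i) u) = y w i) :
    ∑ w ∈ Sf, charLocalLambda (∅ : Set (PadicAlgCl p)) κ θ w ≤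
      zpCorank (↥(unrSelmer κ (charModule (∅ : Set (PadicAlgCl p)) θ) vbar
          (↑Sf : Set (HeightOneSpectrum (𝓞 K)))) ⧸
        (unrSelmer κ (charModule (∅ : Set (PadicAlgCl p)) θ) vbar
          (∅ : Set (HeightOneSpectrum (𝓞 K)))).addSubgroupOf
            (unrSelmer κ (charModule (∅ : Set (PadicAlgCl p)) θ) vbar
              (↑Sf : Set (HeightOneSpectrum (𝓞 K))))) p := by
  have hθ' : ∀ σ : absoluteGaloisGroup K, θ σ ^ (p - 1) = 1 := fun σ ↦ by
    rcases hθ with rfl | rfl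
    · exact (hpair.pow_sub_one σ).1
    · exact (hpair.pow_sub_one σ).2
  exact sum_charLocalLambda_le_zpCorank_unrSelmer_quotient_of_forall_exists κ θ vbar Sf hθ' hγ hSp
    (fun w hw ↦ UnrSelmerQuotientTorsionFiniteChar.exists_mem_decomp_apply_ne_one_of_heegner hK hp2 hH κ
      hκ w ((hSf w).mp hw) (hSp w hw)) a hdiv hd₀ σrep hσrep hsurj

end Character

end Summit.BirchSwinnertonDyer.BirchSwinnertonDyer.Theorems.UnrSelmerLocSurjAdapter

end
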